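import Literature.NumberTheory.QuadraticForms.HasseSymbolsRat
import Mathlib.NumberTheory.LSeries.PrimesInAP
import HarnessLib

/-!
# Rationals with prescribed Hilbert symbols (Serre III §2.2 Thm. 4): the Dirichlet step

Topic `NumberTheory/QuadraticForms`; namespace `Literature.NumberTheory.QuadraticForms`. Everything
here is proved.

Serre, *A Course in Arithmetic*, Ch. III §2.2 Thm. 4: let `(aᵢ)_{i ∈ I}` be a finite family in
`ℚˣ` and `(ε_{i,v})` a family of numbers `±1` indexed by `I` and the places `v` of `ℚ` such that
(1) almost all `ε_{i,v}` are `1`, (2) `∏_v ε_{i,v} = 1` for every `i`, (3) for every `v` there is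
`x_v ∈ ℚ_vˣ` with `(aᵢ, x_v)_v = ε_{i,v}` for all `i`. Then there is `x ∈ ℚˣ` with
`(aᵢ, x)_v = ε_{i,v}` for all `i` and all `v`.

This file proves the **special case of Serre's proof** ("Suppose first that `S ∩ T = ∅`", PDF
p. 25): the `aᵢ` are non-zero integers, `ε_{i,v} = 1` at `∞`, at `2` and at the primes dividing
some `aᵢ`, and the set `T` of primes carrying a sign `-1` consists of odd primes not dividing any
`aᵢ` (`exists_localSign_eq_of_disjoint`). As in Serre, `x = a p` with `a = ∏_{ℓ ∈ T} ℓ` and `p`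
a prime `≡ a (mod 8 ∏ |aᵢ|)` given by **Dirichlet's theorem** (Mathlib
`Nat.forall_exists_prime_gt_and_zmodEq`); the signs are checked place by place with Serre's
explicit formulas (Ch. III §1.2 Thm. 1, `localSign`): at `2` because `x ≡ 1 (mod 8)`, at the
primes of the `aᵢ` because `x ≡ a² (mod p)`, at `ℓ ∈ T` because `(aᵢ, x)_ℓ = (aᵢ / ℓ) =
(aᵢ, x_ℓ)_ℓ`, elsewhere because everything is a unit, and at `p` itself by the product formula
(`totalSign_eq_one`, Ch. III §2.1 Thm. 3). The symbols are Serre's explicit local signs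
`localSign p a b` of integers (equal to the Hilbert symbols of the completions,
`hilbertSymbol_rat_eq_localSign`), so that no completion appears here.

The general theorem (reduction to this case by the approximation theorem) is in
`HilbertSymbolPrescribedRat.lean`.

## References

* J.-P. Serre, *A Course in Arithmetic*, GTM 7, Springer 1973, Ch. III §2.2 Thm. 4 and its proof,
  case `S ∩ T = ∅` (PDF pp. 24–25); §1.2 Thm. 1; §2.1 Thm. 3. [Serre1973]
* P. G. L. Dirichlet (1837), primes in arithmetic progressions — Mathlib `PrimesInAP`.
-/

noncomputable section

open Finset ZMod

namespace Literature.NumberTheory.QuadraticForms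

/-! ### Evaluations of the explicit local signs -/

section Signs

variable {p : ℕ} [hp : Fact p.Prime]

/-- `(A, x)_p = (x / p)^{v_p(A)}` for `p ∤ x` (Serre III Thm. 1 with `β = 0`). [cite: Serre1973, Ch. III §1.2 Thm. 1] -/
theorem localSignOdd_eq_pow_of_not_dvd_right {A x : ℤ} (hx : ¬ (p : ℤ) ∣ x) :
    localSignOdd p A x = legendreSym p x ^ padicValInt p A := by
  rw [localSignOdd_def, padicValInt_of_not_dvd hx, primeCompl_of_not_dvd hx]
  simp

/-- `(A, x)_p = (A / p)^{v_p(x)}` for `p ∤ A` (Serre III Thm. 1 with `α = 0`). [cite: Serre1973, Ch. III §1.2 Thm. 1] -/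
theorem localSignOdd_eq_pow_of_not_dvd_left {A x : ℤ} (hA : ¬ (p : ℤ) ∣ A) :
    localSignOdd p A x = legendreSym p A ^ padicValInt p x := by
  rw [localSignOdd_def, padicValInt_of_not_dvd hA, primeCompl_of_not_dvd hA]
  simp

omit hp in
/-- `(A, x)_2 = 1` (explicit dyadic sign) as soon as `x ≡ 1 (mod 8)`: then `x` is odd with
`χ₄ x = χ₈ x = 1` (Serre III Thm. 1; `x` is a `2`-adic square, II §3.3 Thm. 4).
[cite: Serre1973, Ch. III §1.2 Thm. 1] -/
theorem localSignTwo_eq_one_of_emod_eight {A x : ℤ} (hx : x % 8 = 1) : localSignTwo A x = 1 := by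
  haveI := Fact.mk Nat.prime_two
  have hodd : ¬ ((2 : ℕ) : ℤ) ∣ x := by push_cast; omega
  have h1 : padicValInt 2 x = 0 := padicValInt_of_not_dvd hodd
  have h2 : primeCompl 2 x = x := primeCompl_of_not_dvd hodd
  unfold localSignTwo
  rw [h1, h2]
  have h8 : (x : ZMod 8) = 1 := by
    have h := (ZMod.intCast_eq_intCast_iff' x 1 8).2 (by push_cast; omega)
    simpa using h
  have h4 : (x : ZMod 4) = 1 := by
    have h := (ZMod.intCast_eq_intCast_iff' x 1 4).2 (by push_cast; omega)
    simpa using h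
  have hε : epsSign (primeCompl 2 A) x = 1 := by
    unfold epsSign
    rw [if_neg]
    rw [h4]
    rintro ⟨-, h⟩
    revert h; decide
  rw [hε, h8]
  simp

/-- A sign raised to an odd power `β` equal to `-1` forces `β` odd; then every sign raised to
`β` is itself. Bookkeeping for `(A, x)_ℓ = (A / ℓ)^{v_ℓ(x)}`. [folklore] -/
theorem odd_of_sign_pow_eq_neg_one {s : ℤ} (hs : s = 1 ∨ s = -1) {β : ℕ} (h : s ^ β = -1) :
    Odd β := by
  rcases Nat.even_or_odd β with he | ho
  · rw [pow_eq_one_of_even_of_sign hs he] at h; norm_num at h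
  · exact ho

end Signs

/-! ### Serre's construction `x = a p` -/

section Dirichlet

variable {ι : Type*} [Fintype ι]

/-- The odd square of an integer is `1 mod 8`. [folklore] -/
theorem sq_emod_eight_of_odd {a : ℤ} (ha : Odd a) : (a * a) % 8 = 1 := by
  rcases Dyadic.mod_eight_of_odd ha with h | h | h | h <;>
  · rw [Int.mul_emod, h]; norm_num

/-- **Serre III §2.2 Thm. 4, the case `S ∩ T = ∅`.** Let `Aᵢ` be non-zero integers and `T` a
finite set of odd primes dividing no `Aᵢ`; let `ε : ι → ℕ → ℤ` with `ε i q = 1` at every prime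
`q ∉ T`, `∏_{ℓ ∈ T} ε i ℓ = 1` for all `i` (the product formula, the signs at `∞`, `2` and outside
`T` being `1`), every `ℓ ∈ T` carrying some sign `ε i ℓ = -1`, and suppose that for each `ℓ ∈ T`
some non-zero integer `X_ℓ` has `(Aᵢ, X_ℓ)_ℓ = ε i ℓ` for all `i`. Then there is a positive integer
`x` with `(Aᵢ, x)_q = ε i q` for all `i` and all primes `q` (and `(Aᵢ, x)_∞ = 1`).
Construction: `x = a p`, `a = ∏_{ℓ ∈ T} ℓ`, `p ≡ a (mod 8 ∏ |Aᵢ|)` a large prime (Dirichlet).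
[cite: Serre1973, Ch. III §2.2 Thm. 4] -/
theorem exists_localSign_eq_of_disjoint (A : ι → ℤ) (hA : ∀ i, A i ≠ 0) (ε : ι → ℕ → ℤ)
    (T : Finset ℕ) (hT : ∀ ℓ ∈ T, ℓ.Prime ∧ ℓ ≠ 2 ∧ ∀ i, ¬ (ℓ : ℤ) ∣ A i)
    (hεT : ∀ i (q : ℕ), q.Prime → q ∉ T → ε i q = 1)
    (hTε : ∀ ℓ ∈ T, ∃ i, ε i ℓ = -1)
    (hprod : ∀ i, ∏ ℓ ∈ T, ε i ℓ = 1)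
    (hloc : ∀ ℓ ∈ T, ∃ X : ℤ, X ≠ 0 ∧ ∀ i, localSign ℓ (A i) X = ε i ℓ) :
    ∃ x : ℤ, 0 < x ∧ ∀ i (q : ℕ), q.Prime → localSign q (A i) x = ε i q := by
  classical
  -- `a = ∏ T`, `M = ∏ |A i|`, modulus `m = 8 M`
  set a : ℤ := ∏ ℓ ∈ T, (ℓ : ℤ) with ha_def
  set M : ℕ := ∏ i, (A i).natAbs with hM_def
  have hM0 : M ≠ 0 := Finset.prod_ne_zero_iff.2 fun i _ ↦ Int.natAbs_ne_zero.2 (hA i)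
  have hMdvd : ∀ i, ((A i).natAbs : ℤ) ∣ (M : ℤ) := fun i ↦ by
    rw [hM_def]; push_cast
    exact Finset.dvd_prod_of_mem _ (Finset.mem_univ i)
  set m : ℕ := 8 * M with hm_def
  have hm0 : m ≠ 0 := by positivity
  -- `a` is odd and prime to `M`
  have ha0 : a ≠ 0 := Finset.prod_ne_zero_iff.2 fun ℓ hℓ ↦ by exact_mod_cast (hT ℓ hℓ).1.ne_zero
  have haodd : Odd a := by
    rw [ha_def]
    refine Finset.prod_induction _ Odd (fun x y hx hy ↦ hx.mul hy) odd_one fun ℓ hℓ ↦ ?_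
    rw [Int.odd_coe_nat]
    exact (hT ℓ hℓ).1.odd_of_ne_two (hT ℓ hℓ).2.1
  have hadvd : ∀ q : ℕ, q.Prime → (q : ℤ) ∣ a → q ∈ T := by
    intro q hq hqa
    rw [ha_def] at hqa
    obtain ⟨ℓ, hℓ, hqℓ⟩ := ((Nat.prime_iff_prime_int.1 hq).dvd_finsetProd_iff _).1 hqa
    have : q = ℓ := (Nat.prime_dvd_prime_iff_eq hq (hT ℓ hℓ).1).1 (by exact_mod_cast hqℓ)
    rw [this]; exact hℓ
  have hapos : 0 < a := Finset.prod_pos fun ℓ hℓ ↦ by exact_mod_cast (hT ℓ hℓ).1.pos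
  have haT : ∀ ℓ ∈ T, ¬ (ℓ : ℤ) ∣ (m : ℤ) := by
    intro ℓ hℓ hdvd
    have hℓ' := hT ℓ hℓ
    rw [hm_def, Nat.cast_mul] at hdvd
    rcases (Nat.prime_iff_prime_int.1 hℓ'.1).dvd_or_dvd hdvd with h8 | hM
    · have : ℓ ∣ 8 := by exact_mod_cast h8
      have hle := Nat.le_of_dvd (by norm_num) this
      have h2 : ℓ ∣ 2 ^ 3 := by norm_num; exact this
      exact hℓ'.2.1 ((Nat.prime_dvd_prime_iff_eq hℓ'.1 Nat.prime_two).1 (hℓ'.1.dvd_of_dvd_pow h2))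
    · rw [hM_def] at hM
      push_cast at hM
      obtain ⟨i, -, hi⟩ := ((Nat.prime_iff_prime_int.1 hℓ'.1).dvd_finsetProd_iff _).1 hM
      exact hℓ'.2.2 i ((dvd_abs _ _).1 hi)
  have hcop : IsCoprime a (m : ℤ) := by
    rw [Int.isCoprime_iff_gcd_eq_one, Int.gcd_eq_natAbs, Int.natAbs_natCast]
    refine Nat.Coprime.gcd_eq_one (Nat.coprime_of_dvd fun k hk hka hkm ↦ ?_)
    have hka' : (k : ℤ) ∣ a := Int.ofNat_dvd_left.2 hka
    exact haT k (hadvd k hk hka') (by exact_mod_cast hkm)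
  -- Dirichlet: a prime `p ≡ a (mod m)`, larger than everything in sight
  obtain ⟨p, hpgt, hp, hpmod⟩ :=
    Nat.forall_exists_prime_gt_and_zmodEq (m + T.sup id + 2) (by exact_mod_cast hm0) hcop
  have hpT : p ∉ T := fun h ↦ by
    have := Finset.le_sup (f := id) h
    simp only [id_eq] at this
    omega
  have hp2 : p ≠ 2 := by omega
  have hpa : ¬ (p : ℤ) ∣ a := fun h ↦ hpT (hadvd p hp h)
  haveI hpF : Fact p.Prime := ⟨hp⟩
  -- `x = a p`
  set x : ℤ := a * p with hx_def
  have hxpos : 0 < x := mul_pos hapos (by exact_mod_cast hp.pos)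
  have hx0 : x ≠ 0 := hxpos.ne'
  have hmodm : x ≡ a * a [ZMOD m] := by
    rw [hx_def]; exact hpmod.mul_left a
  have hxmod8 : x % 8 = 1 := by
    have h8 : x ≡ a * a [ZMOD 8] := hmodm.of_dvd (by rw [hm_def]; push_cast; exact dvd_mul_right 8 _)
    rw [Int.ModEq] at h8
    rw [h8, sq_emod_eight_of_odd haodd]
  have hxdvd : ∀ q : ℕ, q.Prime → (q : ℤ) ∣ x → q ∈ T ∨ q = p := by
    intro q hq hqx
    rcases (Nat.prime_iff_prime_int.1 hq).dvd_or_dvd hqx with h | h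
    · exact Or.inl (hadvd q hq h)
    · exact Or.inr ((Nat.prime_dvd_prime_iff_eq hq hp).1 (by exact_mod_cast h))
  have h2T : (2 : ℕ) ∉ T := fun h ↦ (hT 2 h).2.1 rfl
  -- the signs at every prime `q ≠ p`
  have hoff : ∀ i (q : ℕ), q.Prime → q ≠ p → localSign q (A i) x = ε i q := by
    intro i q hq hqp
    by_cases hq2 : q = 2
    · subst hq2
      rw [localSign, if_pos rfl, localSignTwo_eq_one_of_emod_eight hxmod8, hεT i 2 Nat.prime_two h2T]
    haveI := Fact.mk hq
    rw [localSign, if_neg hq2]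
    by_cases hqT : q ∈ T
    · -- `q = ℓ ∈ T`: `(A i, x)_ℓ = (A i / ℓ) = (A i, X_ℓ)_ℓ`
      obtain ⟨X, hX0, hX⟩ := hloc q hqT
      obtain ⟨i₀, hi₀⟩ := hTε q hqT
      have hqA : ∀ j, ¬ (q : ℤ) ∣ A j := (hT q hqT).2.2
      have hqA0 : ∀ j, ((A j : ℤ) : ZMod q) ≠ 0 := fun j ↦ by
        rw [Ne, ZMod.intCast_zmod_eq_zero_iff_dvd]; exact hqA j
      -- `v_q(x) = 1`
      have hvx : padicValInt q x = 1 := by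
        set a' : ℤ := ∏ ℓ ∈ T.erase q, (ℓ : ℤ) with ha'
        have haq : a = q * a' := by rw [ha_def, ha', Finset.mul_prod_erase _ _ hqT]
        have hqa' : ¬ (q : ℤ) ∣ a' := by
          intro h
          rw [ha'] at h
          obtain ⟨ℓ, hℓ, hqℓ⟩ := ((Nat.prime_iff_prime_int.1 hq).dvd_finsetProd_iff _).1 h
          have hℓT := Finset.mem_of_mem_erase hℓ
          have : q = ℓ := (Nat.prime_dvd_prime_iff_eq hq (hT ℓ hℓT).1).1 (by exact_mod_cast hqℓ)
          exact Finset.ne_of_mem_erase hℓ this.symm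
        refine (padicValInt_eq_of_eq_pow_mul (a := x) (n := 1) (u := a' * p) (fun h ↦ ?_)
          (by rw [hx_def, haq]; ring)).1
        rcases (Nat.prime_iff_prime_int.1 hq).dvd_or_dvd h with h | h
        · exact hqa' h
        · exact hqp ((Nat.prime_dvd_prime_iff_eq hq hp).1 (by exact_mod_cast h))
      rw [localSignOdd_eq_pow_of_not_dvd_left (hqA i), hvx, pow_one]
      -- the local datum: `ε j q = (A j / q)^β` with `β` odd
      have hXj : ∀ j, ε j q = legendreSym q (A j) ^ padicValInt q X := fun j ↦ by
        rw [← hX j, localSign, if_neg hq2, localSignOdd_eq_pow_of_not_dvd_left (hqA j)]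
      have hβ : Odd (padicValInt q X) :=
        odd_of_sign_pow_eq_neg_one (legendreSym.eq_one_or_neg_one q (hqA0 i₀)) (by rw [← hXj, hi₀])
      rw [hXj i, pow_eq_self_of_odd_of_sign (legendreSym.eq_one_or_neg_one q (hqA0 i)) hβ]
    · -- `q ∉ T`, `q ≠ p, 2`: `ε i q = 1` and `(A i, x)_q = (x / q)^{v_q(A i)} = 1`
      rw [hεT i q hq hqT]
      have hqx : ¬ (q : ℤ) ∣ x := fun h ↦ by
        rcases hxdvd q hq h with h' | h'
        · exact hqT h'
        · exact hqp h'
      rw [localSignOdd_eq_pow_of_not_dvd_right hqx]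
      by_cases hqAi : (q : ℤ) ∣ A i
      · -- `q ∣ M ∣ m`: `x ≡ a² (mod q)`
        have hqM : (q : ℤ) ∣ (M : ℤ) := (Int.dvd_natAbs.2 hqAi).trans (hMdvd i)
        have hqm : (q : ℤ) ∣ (m : ℤ) := by rw [hm_def]; push_cast; exact hqM.mul_left 8
        have hmodq : x ≡ a * a [ZMOD q] := hmodm.of_dvd hqm
        have hqa : ((a : ℤ) : ZMod q) ≠ 0 := by
          rw [Ne, ZMod.intCast_zmod_eq_zero_iff_dvd]
          exact fun h ↦ hqT (hadvd q hq h)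
        rw [legendreSym.mod, hmodq, ← legendreSym.mod, ← sq, legendreSym.sq_one' q hqa, one_pow]
      · rw [padicValInt_of_not_dvd hqAi, pow_zero]
  -- the sign at `p` by the product formula
  have hon : ∀ i, localSign p (A i) x = ε i p := by
    intro i
    set D : Finset ℕ := (M.primeFactors.erase 2) \ T with hD
    set R : Finset ℕ := T ∪ D with hR
    have hpR : p ∉ R := by
      rw [hR, Finset.mem_union, not_or]
      refine ⟨hpT, fun h ↦ ?_⟩
      rw [hD, Finset.mem_sdiff, Finset.mem_erase, Nat.mem_primeFactors] at h
      have hpM : (p : ℤ) ∣ (m : ℤ) := by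
        rw [hm_def]; push_cast; exact (Int.natCast_dvd_natCast.2 h.1.2.2.1).mul_left 8
      exact hpa (by
        have h1 : (p : ℤ) ∣ x - a * a := by
          have := (Int.ModEq.dvd hmodm.symm)
          exact hpM.trans (by simpa using this)
        have h2 : (p : ℤ) ∣ x := by rw [hx_def]; exact Dvd.intro_left _ rfl
        have h3 : (p : ℤ) ∣ a * a := by
          have := (Int.dvd_sub h2 h1); simpa using this
        rcases (Nat.prime_iff_prime_int.1 hp).dvd_or_dvd h3 with h | h <;> exact h)
    set S' : Finset ℕ := insert p R with hS'
    have hS'prime : ∀ q ∈ S', q.Prime ∧ q ≠ 2 := by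
      intro q hq
      rw [hS', Finset.mem_insert, hR, Finset.mem_union] at hq
      rcases hq with rfl | hq | hq
      · exact ⟨hp, hp2⟩
      · exact ⟨(hT q hq).1, (hT q hq).2.1⟩
      · rw [hD, Finset.mem_sdiff, Finset.mem_erase] at hq
        exact ⟨Nat.prime_of_mem_primeFactors hq.1.2, hq.1.1⟩
    have hSa : ∀ q : ℕ, q.Prime → q ≠ 2 → (q : ℤ) ∣ A i → q ∈ S' := by
      intro q hq hq2 hqA
      rw [hS', Finset.mem_insert, hR, Finset.mem_union]
      by_cases hqT : q ∈ T
      · exact Or.inr (Or.inl hqT)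
      · refine Or.inr (Or.inr ?_)
        rw [hD, Finset.mem_sdiff, Finset.mem_erase, Nat.mem_primeFactors]
        refine ⟨⟨hq2, hq, ?_, hM0⟩, hqT⟩
        exact Int.natCast_dvd_natCast.1 ((Int.dvd_natAbs.2 hqA).trans (hMdvd i))
    have hSb : ∀ q : ℕ, q.Prime → q ≠ 2 → (q : ℤ) ∣ x → q ∈ S' := by
      intro q hq _ hqx
      rw [hS', Finset.mem_insert, hR, Finset.mem_union]
      rcases hxdvd q hq hqx with h | h
      · exact Or.inr (Or.inl h)
      · exact Or.inl h
    have htot := totalSign_eq_one S' hS'prime (hA i) hx0 hSa hSb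
    rw [totalSign, localSignInfty_of_pos_right _ hxpos, localSignTwo_eq_one_of_emod_eight hxmod8,
      one_mul, one_mul, hS', Finset.prod_insert hpR] at htot
    -- the other factors are the `ε i q`, whose product is `1`
    have hrest : ∏ q ∈ R, localSignOdd q (A i) x = 1 := by
      have h1 : ∏ q ∈ R, localSignOdd q (A i) x = ∏ q ∈ R, ε i q := by
        refine Finset.prod_congr rfl fun q hq ↦ ?_
        have hq' := hS'prime q (by rw [hS']; exact Finset.mem_insert_of_mem hq)
        have := hoff i q hq'.1 (fun h ↦ hpR (h ▸ hq))
        rwa [localSign, if_neg hq'.2] at this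
      rw [h1, hR, Finset.prod_union (Finset.disjoint_sdiff), hprod i, one_mul]
      refine Finset.prod_eq_one fun q hq ↦ ?_
      have hq' : q ∈ (M.primeFactors.erase 2) \ T := hq
      rw [Finset.mem_sdiff, Finset.mem_erase] at hq'
      exact hεT i q (Nat.prime_of_mem_primeFactors hq'.1.2) hq'.2
    rw [hrest, mul_one] at htot
    rw [localSign, if_neg hp2, htot, hεT i p hp hpT]
  refine ⟨x, hxpos, fun i q hq ↦ ?_⟩
  by_cases hqp : q = p
  · subst hqp; exact hon i
  · exact hoff i q hq hqp

end Dirichlet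

end Literature.NumberTheory.QuadraticForms
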